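import Mathlib
import Summits.Ventures.PercRepro2.Defs

/-!
# Finite bond percolation — symmetry, forcing and independence (blind cell PercRepro2, typer-1)

* `flipEdge e` — the involution toggling edge `e`; `weight p (flipEdge e ω) = weight p[e↦1-p e] ω`.
* `expect_update_one` — `E_{p[e↦1]} f = E_p (f ∘ (· with e forced open))`: a pinned edge is the
  same as forcing it in the observable.
* `glue F σ₁ σ₂` — assemble a configuration from its restrictions to `F` and `Fᶜ`; the weight
  factorises (`weight_glue`) and sums split (`sum_glue`).
* `prob_inter_eq_mul_of_dependsOn` — **independence**: events determined by disjoint edge sets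
  (Mathlib's `DependsOn`) have product probabilities.  This is the finite-sum form of the
  spatial / domain Markov property: after exploring an edge set, the unexplored edges are
  an independent percolation.
-/

namespace Summit.Ventures.PercRepro2

section Flip

variable {E : Type*} [Fintype E] [DecidableEq E] {R : Type*} [CommRing R]

/-- Toggle the state of the edge `e`. -/
def flipEdge (e : E) (ω : Config E) : Config E := Function.update ω e (!ω e)

omit [Fintype E] in
/-- `flipEdge` at the flipped edge. -/
@[simp] lemma flipEdge_apply_self (e : E) (ω : Config E) : flipEdge e ω e = !ω e := by
  simp [flipEdge]

omit [Fintype E] in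
/-- `flipEdge` away from the flipped edge. -/
lemma flipEdge_apply_of_ne {e e' : E} (h : e' ≠ e) (ω : Config E) : flipEdge e ω e' = ω e' := by
  simp [flipEdge, Function.update_of_ne h]

omit [Fintype E] in
/-- Flipping twice is the identity. -/
lemma flipEdge_involutive (e : E) : Function.Involutive (flipEdge e) := by
  intro ω
  funext e'
  by_cases h : e' = e
  · subst h; simp [flipEdge]
  · simp [flipEdge, Function.update_of_ne h]

/-- `flipEdge e` as a permutation of the configurations. -/
def flipEdgeEquiv (e : E) : Equiv.Perm (Config E) := (flipEdge_involutive e).toPerm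

omit [Fintype E] in
/-- Forcing `e` open after flipping it is the same as forcing it open. -/
lemma update_flipEdge (e : E) (ω : Config E) (b : Bool) :
    Function.update (flipEdge e ω) e b = Function.update ω e b := by
  simp [flipEdge, Function.update_idem]

/-- Re-indexing a sum over configurations by `flipEdge e`. -/
lemma sum_flipEdge (e : E) (G : Config E → R) : ∑ ω, G (flipEdge e ω) = ∑ ω, G ω :=
  Equiv.sum_comp (flipEdgeEquiv e) G

/-- **Flip symmetry**: toggling edge `e` in the configuration is the same as replacing
`p e` by `1 - p e` in the weights. -/
lemma weight_flipEdge (p : E → R) (e : E) (ω : Config E) :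
    weight p (flipEdge e ω) = weight (Function.update p e (1 - p e)) ω := by
  unfold weight
  refine Finset.prod_congr rfl fun e' _ => ?_
  by_cases h : e' = e
  · subst h
    cases hω : ω e' <;> simp [hω, edgeFactor]
  · simp [flipEdge_apply_of_ne h, Function.update_of_ne h]

/-- Under `p[e↦1]`, forcing `e` open in the observable changes nothing. -/
lemma weight_update_one_mul_update (p : E → R) (e : E) (g : Config E → R) (ω : Config E) :
    weight (Function.update p e 1) ω * g (Function.update ω e true) =
      weight (Function.update p e 1) ω * g ω := by
  by_cases h : ω e = true
  · rw [show Function.update ω e true = ω by rw [← h]; exact Function.update_eq_self e ω]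
  · simp only [Bool.not_eq_true] at h
    rw [weight_update_one_of_eq_false p h, zero_mul, zero_mul]

/-- Under `p[e↦0]`, forcing `e` closed in the observable changes nothing. -/
lemma weight_update_zero_mul_update (p : E → R) (e : E) (g : Config E → R) (ω : Config E) :
    weight (Function.update p e 0) ω * g (Function.update ω e false) =
      weight (Function.update p e 0) ω * g ω := by
  by_cases h : ω e = true
  · rw [weight_update_zero_of_eq_true p h, zero_mul, zero_mul]
  · simp only [Bool.not_eq_true] at h
    rw [show Function.update ω e false = ω by rw [← h]; exact Function.update_eq_self e ω]

/-- **Forcing identity, open case**: the expectation with `e` pinned open equals the expectation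
(under the original weights) of the observable evaluated with `e` forced open. -/
lemma expect_update_one (p : E → R) (f : Config E → R) (e : E) :
    expect (Function.update p e 1) f = expect p (fun ω => f (Function.update ω e true)) := by
  rw [expect_eq_pin p _ e]
  have h1 : expect (Function.update p e 1) (fun ω => f (Function.update ω e true)) =
      expect (Function.update p e 1) f :=
    Finset.sum_congr rfl fun ω _ => weight_update_one_mul_update p e f ω
  have h0 : expect (Function.update p e 0) (fun ω => f (Function.update ω e true)) =
      expect (Function.update p e 1) f := by
    unfold expect
    rw [← sum_flipEdge e]
    refine Finset.sum_congr rfl fun ω _ => ?_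
    simp only [weight_flipEdge, Function.update_self, sub_zero, Function.update_idem,
      update_flipEdge]
    exact weight_update_one_mul_update p e f ω
  rw [h1, h0]
  ring

/-- **Forcing identity, closed case**. -/
lemma expect_update_zero (p : E → R) (f : Config E → R) (e : E) :
    expect (Function.update p e 0) f = expect p (fun ω => f (Function.update ω e false)) := by
  rw [expect_eq_pin p _ e]
  have h0 : expect (Function.update p e 0) (fun ω => f (Function.update ω e false)) =
      expect (Function.update p e 0) f :=
    Finset.sum_congr rfl fun ω _ => weight_update_zero_mul_update p e f ω
  have h1 : expect (Function.update p e 1) (fun ω => f (Function.update ω e false)) =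
      expect (Function.update p e 0) f := by
    unfold expect
    rw [← sum_flipEdge e]
    refine Finset.sum_congr rfl fun ω _ => ?_
    simp only [weight_flipEdge, Function.update_self, sub_self, Function.update_idem,
      update_flipEdge]
    exact weight_update_zero_mul_update p e f ω
  rw [h1, h0]
  ring

end Flip

/-! ## Splitting configurations along an edge set -/

section GlueDefs

variable {E : Type*}

/-- Assemble a configuration from its restriction `σ₁` to `F` and its restriction `σ₂` to the
complement of `F`. -/
def glue (F : Set E) [DecidablePred (· ∈ F)] (σ₁ : {e // e ∈ F} → Bool)
    (σ₂ : {e // e ∉ F} → Bool) : Config E :=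
  fun e => if h : e ∈ F then σ₁ ⟨e, h⟩ else σ₂ ⟨e, h⟩

/-- `glue` on an edge of `F`. -/
lemma glue_apply_of_mem (F : Set E) [DecidablePred (· ∈ F)] (σ₁ : {e // e ∈ F} → Bool)
    (σ₂ : {e // e ∉ F} → Bool) {e : E} (h : e ∈ F) : glue F σ₁ σ₂ e = σ₁ ⟨e, h⟩ := dif_pos h

/-- `glue` on an edge outside `F`. -/
lemma glue_apply_of_notMem (F : Set E) [DecidablePred (· ∈ F)] (σ₁ : {e // e ∈ F} → Bool)
    (σ₂ : {e // e ∉ F} → Bool) {e : E} (h : e ∉ F) : glue F σ₁ σ₂ e = σ₂ ⟨e, h⟩ := dif_neg h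

/-- `glue F` is the inverse of Mathlib's splitting equivalence `Equiv.piEquivPiSubtypeProd`. -/
lemma glue_eq_symm (F : Set E) [DecidablePred (· ∈ F)] (σ₁ : {e // e ∈ F} → Bool)
    (σ₂ : {e // e ∉ F} → Bool) :
    glue F σ₁ σ₂ = (Equiv.piEquivPiSubtypeProd (· ∈ F) (fun _ => Bool)).symm (σ₁, σ₂) := rfl

end GlueDefs

section Glue

variable {E : Type*} [Fintype E] [DecidableEq E] {R : Type*} [CommRing R]

/-- A sum over all configurations splits as a double sum over the two restrictions. -/
lemma sum_glue (F : Set E) [DecidablePred (· ∈ F)] (G : Config E → R) :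
    ∑ ω, G ω = ∑ σ₁ : {e // e ∈ F} → Bool, ∑ σ₂ : {e // e ∉ F} → Bool, G (glue F σ₁ σ₂) := by
  rw [← Equiv.sum_comp (Equiv.piEquivPiSubtypeProd (· ∈ F) (fun _ => Bool)).symm G,
    Fintype.sum_prod_type]
  rfl

omit [DecidableEq E] in
/-- The weight factorises along `F` and its complement. -/
lemma weight_glue (p : E → R) (F : Set E) [DecidablePred (· ∈ F)] (σ₁ : {e // e ∈ F} → Bool)
    (σ₂ : {e // e ∉ F} → Bool) :
    weight p (glue F σ₁ σ₂) =
      weight (fun i : {e // e ∈ F} => p i) σ₁ * weight (fun i : {e // e ∉ F} => p i) σ₂ := by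
  unfold weight
  rw [← Fintype.prod_subtype_mul_prod_subtype (· ∈ F)]
  congr 1
  · exact Finset.prod_congr rfl fun i _ => by rw [glue_apply_of_mem F σ₁ σ₂ i.2]
  · exact Finset.prod_congr rfl fun i _ => by rw [glue_apply_of_notMem F σ₁ σ₂ i.2]

/-- An expectation as a double sum over the restrictions to `F` and `Fᶜ`. -/
lemma expect_eq_sum_glue (p : E → R) (f : Config E → R) (F : Set E) [DecidablePred (· ∈ F)] :
    expect p f = ∑ σ₁ : {e // e ∈ F} → Bool, ∑ σ₂ : {e // e ∉ F} → Bool,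
      weight (fun i : {e // e ∈ F} => p i) σ₁ * weight (fun i : {e // e ∉ F} => p i) σ₂ *
        f (glue F σ₁ σ₂) := by
  unfold expect
  rw [sum_glue F]
  exact Finset.sum_congr rfl fun σ₁ _ => Finset.sum_congr rfl fun σ₂ _ => by rw [weight_glue]

end Glue

/-! ## Events determined by a set of edges -/

section DependsOn

variable {E : Type*}

/-- If the event `A` is determined by the edges in `F`, membership only depends on those edges. -/
lemma dependsOn_mem_iff {A : Set (Config E)} {F : Set E} (hA : DependsOn (· ∈ A) F)
    {ω ω' : Config E} (h : ∀ e ∈ F, ω e = ω' e) : ω ∈ A ↔ ω' ∈ A :=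
  (hA h).to_iff

/-- The event `{e open}` is determined by the edge `e`. -/
lemma dependsOn_openEdge (e : E) : DependsOn (· ∈ openEdge e) ({e} : Set E) := by
  intro ω ω' h
  show (ω e = true) = (ω' e = true)
  rw [h e (Set.mem_singleton e)]

/-- The event `{e closed}` is determined by the edge `e`. -/
lemma dependsOn_closedEdge (e : E) : DependsOn (· ∈ closedEdge e) ({e} : Set E) := by
  intro ω ω' h
  show (ω e = false) = (ω' e = false)
  rw [h e (Set.mem_singleton e)]

/-- Intersections of events determined by `F₁`, `F₂` are determined by `F₁ ∪ F₂`. -/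
lemma dependsOn_inter {A B : Set (Config E)} {F₁ F₂ : Set E} (hA : DependsOn (· ∈ A) F₁)
    (hB : DependsOn (· ∈ B) F₂) : DependsOn (· ∈ A ∩ B) (F₁ ∪ F₂) := by
  intro ω ω' h
  exact propext (and_congr (dependsOn_mem_iff hA fun i hi => h i (Or.inl hi))
    (dependsOn_mem_iff hB fun i hi => h i (Or.inr hi)))

/-- Unions of events determined by `F₁`, `F₂` are determined by `F₁ ∪ F₂`. -/
lemma dependsOn_union {A B : Set (Config E)} {F₁ F₂ : Set E} (hA : DependsOn (· ∈ A) F₁)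
    (hB : DependsOn (· ∈ B) F₂) : DependsOn (· ∈ A ∪ B) (F₁ ∪ F₂) := by
  intro ω ω' h
  exact propext (or_congr (dependsOn_mem_iff hA fun i hi => h i (Or.inl hi))
    (dependsOn_mem_iff hB fun i hi => h i (Or.inr hi)))

/-- The complement of an event determined by `F` is determined by `F`. -/
lemma dependsOn_compl {A : Set (Config E)} {F : Set E} (hA : DependsOn (· ∈ A) F) :
    DependsOn (· ∈ Aᶜ) F := by
  intro ω ω' h
  exact propext (not_congr (dependsOn_mem_iff hA h))

/-- Every event is determined by the set of all edges. -/
lemma dependsOn_univ' (A : Set (Config E)) : DependsOn (· ∈ A) (Set.univ : Set E) :=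
  dependsOn_univ _

end DependsOn

/-! ## Independence -/

section Independence

variable {E : Type*} [Fintype E] [DecidableEq E] {R : Type*} [CommRing R]

omit [Fintype E] [DecidableEq E] in
/-- Indicator of an intersection is the product of indicators. -/
lemma indicator_inter_one (A B : Set (Config E)) (ω : Config E) :
    (A ∩ B).indicator (1 : Config E → R) ω = A.indicator 1 ω * B.indicator 1 ω := by
  by_cases hA : ω ∈ A <;> by_cases hB : ω ∈ B <;> simp [hA, hB]

/-- **Independence (product rule)**: if `A` is determined by the edges in `F` and `B` by the
edges outside `F`, then `P(A ∩ B) = P(A) · P(B)`. -/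
theorem prob_inter_eq_mul_of_dependsOn_compl (p : E → R) (F : Set E) [DecidablePred (· ∈ F)]
    {A B : Set (Config E)} (hA : DependsOn (· ∈ A) F) (hB : DependsOn (· ∈ B) Fᶜ) :
    prob p (A ∩ B) = prob p A * prob p B := by
  -- representatives of the two factors
  let a : ({e // e ∈ F} → Bool) → R := fun σ₁ => A.indicator 1 (glue F σ₁ fun _ => false)
  let b : ({e // e ∉ F} → Bool) → R := fun σ₂ => B.indicator 1 (glue F (fun _ => false) σ₂)
  have ha : ∀ σ₁ σ₂, A.indicator (1 : Config E → R) (glue F σ₁ σ₂) = a σ₁ := by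
    intro σ₁ σ₂
    have hiff : glue F σ₁ σ₂ ∈ A ↔ glue F σ₁ (fun _ => false) ∈ A :=
      dependsOn_mem_iff hA fun i hi => by rw [glue_apply_of_mem F _ _ hi, glue_apply_of_mem F _ _ hi]
    by_cases h : glue F σ₁ σ₂ ∈ A
    · simp [a, h, hiff.1 h]
    · have h2 : glue F σ₁ (fun _ => false) ∉ A := fun h' => h (hiff.2 h')
      simp [a, h, h2]
  have hb : ∀ σ₁ σ₂, B.indicator (1 : Config E → R) (glue F σ₁ σ₂) = b σ₂ := by
    intro σ₁ σ₂
    have hiff : glue F σ₁ σ₂ ∈ B ↔ glue F (fun _ => false) σ₂ ∈ B :=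
      dependsOn_mem_iff hB fun i hi => by
        rw [glue_apply_of_notMem F _ _ hi, glue_apply_of_notMem F _ _ hi]
    by_cases h : glue F σ₁ σ₂ ∈ B
    · simp [b, h, hiff.1 h]
    · have h2 : glue F (fun _ => false) σ₂ ∉ B := fun h' => h (hiff.2 h')
      simp [b, h, h2]
  have hsum₁ : ∑ σ₁ : {e // e ∈ F} → Bool, weight (fun i : {e // e ∈ F} => p i) σ₁ = 1 :=
    sum_weight _
  have hsum₂ : ∑ σ₂ : {e // e ∉ F} → Bool, weight (fun i : {e // e ∉ F} => p i) σ₂ = 1 :=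
    sum_weight _
  have e1 : prob p A = ∑ σ₁, weight (fun i : {e // e ∈ F} => p i) σ₁ * a σ₁ := by
    rw [prob_eq_expect_indicator, expect_eq_sum_glue p _ F]
    refine Finset.sum_congr rfl fun σ₁ _ => ?_
    calc ∑ σ₂, weight (fun i : {e // e ∈ F} => p i) σ₁ * weight (fun i : {e // e ∉ F} => p i) σ₂
          * A.indicator 1 (glue F σ₁ σ₂)
        = ∑ σ₂, (weight (fun i : {e // e ∈ F} => p i) σ₁ * a σ₁) *
            weight (fun i : {e // e ∉ F} => p i) σ₂ :=
          Finset.sum_congr rfl fun σ₂ _ => by rw [ha]; ring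
      _ = weight (fun i : {e // e ∈ F} => p i) σ₁ * a σ₁ := by
          rw [← Finset.mul_sum, hsum₂, mul_one]
  have e2 : prob p B = ∑ σ₂, weight (fun i : {e // e ∉ F} => p i) σ₂ * b σ₂ := by
    rw [prob_eq_expect_indicator, expect_eq_sum_glue p _ F, Finset.sum_comm]
    refine Finset.sum_congr rfl fun σ₂ _ => ?_
    calc ∑ σ₁, weight (fun i : {e // e ∈ F} => p i) σ₁ * weight (fun i : {e // e ∉ F} => p i) σ₂
          * B.indicator 1 (glue F σ₁ σ₂)
        = ∑ σ₁, (weight (fun i : {e // e ∉ F} => p i) σ₂ * b σ₂) *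
            weight (fun i : {e // e ∈ F} => p i) σ₁ :=
          Finset.sum_congr rfl fun σ₁ _ => by rw [hb]; ring
      _ = weight (fun i : {e // e ∉ F} => p i) σ₂ * b σ₂ := by
          rw [← Finset.mul_sum, hsum₁, mul_one]
  have e3 : prob p (A ∩ B) = (∑ σ₁, weight (fun i : {e // e ∈ F} => p i) σ₁ * a σ₁) *
      ∑ σ₂, weight (fun i : {e // e ∉ F} => p i) σ₂ * b σ₂ := by
    rw [prob_eq_expect_indicator, expect_eq_sum_glue p _ F, Finset.sum_mul_sum]
    refine Finset.sum_congr rfl fun σ₁ _ => Finset.sum_congr rfl fun σ₂ _ => ?_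
    rw [indicator_inter_one, ha, hb]
    ring
  rw [e1, e2, e3]

/-- **Independence for disjoint edge sets**: events determined by disjoint sets of edges
are independent. -/
theorem prob_inter_eq_mul_of_dependsOn (p : E → R) {F₁ F₂ : Set E} (hF : Disjoint F₁ F₂)
    {A B : Set (Config E)} (hA : DependsOn (· ∈ A) F₁) (hB : DependsOn (· ∈ B) F₂) :
    prob p (A ∩ B) = prob p A * prob p B := by
  classical
  exact prob_inter_eq_mul_of_dependsOn_compl p F₁ hA
    (DependsOn.mono (fun e he heF => Set.disjoint_left.1 hF heF he) hB)

end Independence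

end Summit.Ventures.PercRepro2
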